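import Summits.ResolutionOfSingularities.ResolutionOfSingularities.Theorems.PurelyInseparableDim4ResConeFrameJet
import Summits.ResolutionOfSingularities.ResolutionOfSingularities.Theorems.PurelyInseparableDim4ResConeLossyTiltFreeInert
import HarnessLib
import HarnessLib.Audit.Tags

/-!
# Purely inseparable four-folds — THE LOSE-BOTH PACKAGE OF A TILTED BINARY-CONE TAIL at `(p, d) = (5, 4)` in moving
# linear frames (K2(p) lane, SLICE C, brick (ii) «tilted reduction», FILE 3c; file-holder res-dim4-p-5 g4)

[OURS · counted 0 · cell `res-dim4-pi` · K2(p) lane, slice C (desk WORD #155) · seat p-5 g4.]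
Nothing here proves K2(p)/K2(5), `NoIsolatedTrap p p` or resolution of singularities in dimension ≥ 4 / char. `p`.
SETTING: isolated above-floor witnessed `Step0 5` chain, `x^{r₀} ∣ F₀`, constant `(4, e_G = 2)` from `k₀`, chart
letters in `{a, a′}`, PASSIVE-FREE, polar kernel possibly TILTED `⟨e_a + φ, e_{a′} + ψ⟩`; a lose-both step `k`
(chart `a`, `t = b k a′ ≠ 0`); frame bookkeeping (`isIsolated_shear_iff`, FRAME ⇒ VERTEX `single_mem_resVertex_of_shear`)
from `…ResConeFrameJet`.  **`tilted_loseBoth_package`** — forced ledger (weights `(2,1)`), the child's `a`-tilt `φ′` persisting to the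
grandchild, FILES 1a–1c applied to `Θ (c k).F` (`Θ : x_i ↦ x_i + φ_i x_a + ψ_i x_{a′} + φ′_i x_a²`,
`…FrameConjugation`), `shear_a φ′ (shear_{a′} ψ (c (k+1)).F)`, `shear_a φ′ (c (k+2)).F`: (D1) in the frame `Θ`, the
(D2) SEED `x_a⁴x_{a′}⁴ ∨ x_a⁴x_{a′}⁵` of `shear_a φ′ (c (k+2)).F`, the grandchild's degree-`7` row is
`x_a²x_{a′}·(inert cubic)` there (degree-`8` rows of `x_a`-exponent `2` have `x_{a′}`-exponent `2`), and
`e_{a′} ∈ resVertex (c (k+2))` (the `a′`-tilt DIES in a lose-both pair).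
NOT here: the end game in moving frames (FILE 3d).  [cite: CossartJannsenSaito2020, Thm. 3.14, Lemma 13.2, Thm. 13.7]
[cite: Hauser2010, §I (definition of P⁺, kangaroo phenomenon)]
bears_on: LADDER-RESOLUTION:D157-DOOR2 (res-dim4-pi · K2(p) = `RidgeBudget.NoAboveFloorTrap p p` · slice C, tilted residual).
Supports stmt-ResolutionOfSingularities-16155 (helper).
-/

set_option linter.dupNamespace false -- mandated namespace of this single-conjunct summit

noncomputable section

namespace Summit.ResolutionOfSingularities.ResolutionOfSingularities.Theorems.PIDim4

namespace ResCone

open MvPolynomial Finset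
open Literature.AlgebraicGeometry.Resolution
open Literature.AlgebraicGeometry.Resolution.CentreBlowup
open Literature.AlgebraicGeometry.Resolution.Hauser2010
open Literature.AlgebraicGeometry.Resolution.HauserPerlega2019
open PointBlowup (polarMap additiveSubspace direction)

variable {K : Type} [Field K] [CharP K 5] [DecidableEq K]

section TiltedLoseBoth

/-- **THE TILTED LOSE-BOTH PACKAGE** (brick (ii), (PC) reduction).  A lossy binary-cone tail, chart letters in
`{a, a′}`, passive letters untranslated, at a LOSE-BOTH time `k` (`j k = a`, `t = b_k(a′) ≠ 0`) with tilted vertex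
`⟨e_a + φ, e_{a′} + ψ⟩` is put BY MOVING FRAMES in the position of FILES 1a–1c: the parent re-coordinatised by the
jet `x_i ↦ x_i + φ_i x_a + ψ_i x_{a′} + φ′_i x_a²` (`φ′` the grandchild's `a`-tilt), the pure-shear child
`F₁ = shear a φ′ (shear a′ ψ F_{k+1})` and the grandchild in its own frame `F₂ = shear a φ′ F_{k+2}` satisfy the
hypotheses of `seed_dichotomy` (3a `coeff_step_frame` twice, 3b `inert_of_straighten_jet` / `free_of_straighten_one`).
CONCLUSIONS: forced ledger (`α + β = 3`, `r_{k+2} = 2e_a + e_{a′}`), (D1) legality of the jet-parent, the (D2) SEED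
`x_a⁴x_{a′}⁴ ∨ x_a⁴x_{a′}⁵` in the grandchild's frame, the grandchild's degree-`7` row is `x_a² x_{a′}·(inert cubic)`
there (and its degree-`8` monomials of `x_a`-exponent `2` have `x_{a′}`-exponent `2`: transport `|E| = E a′ + 6`), and —
un-shearing — `e_{a′} ∈ Vtx(c (k+2))` on the nose (the `a′`-tilt is killed by the re-entry).
[OURS] [cite: Hauser2010, §I (definition of P⁺, kangaroo phenomenon)] [cite: CossartJannsenSaito2020, Lemma 13.2,
Thm. 13.7] -/
theorem tilted_loseBoth_package {c : ℕ → State K} {j : ℕ → Fin 4} {b : ℕ → Fin 4 → K}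
    (hc : ∀ k, IsIsolated 5 (c k).F ∧ Step0 5 (c k) (c (k + 1))) (hw : FreeTail.IsWitnessedChain 5 c j b)
    (hr0 : ∀ e ∈ (c 0).F.support, (c 0).r ≤ e) (hfloor : ∀ k, ordZero (c k).F ≠ 5) {k₀ : ℕ}
    (hshade : ∀ k, k₀ ≤ k → (c k).shade = ((4 : ℕ) : ℕ∞))
    (he : ∀ k, k₀ ≤ k → Module.finrank K (resVertex (c k)) = 2) {a a' : Fin 4} (haa : a ≠ a')
    (hletters : ∀ k, k₀ ≤ k → (j k = a ∨ j k = a'))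
    (hpass : ∀ k, k₀ ≤ k → ∀ i, i ≠ a → i ≠ a' → (c k).r i = 0)
    {k : ℕ} (hk : k₀ ≤ k) (hjk : j k = a) (ht : b k a' ≠ 0)
    {φ ψ : Fin 4 → K} (hφa : φ a = 0) (hφa' : φ a' = 0) (hψa : ψ a = 0) (hψa' : ψ a' = 0)
    (hφV : (Pi.single a 1 : Fin 4 → K) + φ ∈ resVertex (c k))
    (hψV : (Pi.single a' 1 : Fin 4 → K) + ψ ∈ resVertex (c k)) :
    ∃ φ' : Fin 4 → K, φ' a = 0 ∧ φ' a' = 0 ∧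
    (Pi.single a 1 : Fin 4 → K) + φ' ∈ resVertex (c (k + 2)) ∧
    (Pi.single a' 1 : Fin 4 → K) ∈ resVertex (c (k + 2)) ∧
    (c k).r a + (c k).r a' = 3 ∧
    (c (k + 2)).r = Finsupp.single a 2 + Finsupp.single a' 1 ∧
    (∀ m : Fin 4 →₀ ℕ, m.degree = 8 → degIn ((Finset.univ.erase a).erase a') m ≤ 1 →
      coeff m (aeval (fun i => (X i : MvPolynomial (Fin 4) K) + C (φ i) * X a + C (ψ i) * X a' +
        C (φ' i) * X a ^ 2) (c k).F) = 0) ∧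
    (∀ i, 2 ≤ i → i ≤ 4 →
      coeff ((c k).r + (Finsupp.single a (6 - i) + Finsupp.single a' i))
        (aeval (fun i => (X i : MvPolynomial (Fin 4) K) + C (φ i) * X a + C (ψ i) * X a' +
          C (φ' i) * X a ^ 2) (c k).F) = 0) ∧
    (coeff (Finsupp.single a 4 + Finsupp.single a' 4) (shear a φ' (c (k + 2)).F) ≠ 0 ∨
      coeff (Finsupp.single a 4 + Finsupp.single a' 5) (shear a φ' (c (k + 2)).F) ≠ 0) ∧
    (∀ E ∈ (shear a φ' (c (k + 2)).F).support, E.degree = 7 → E a = 2 ∧ E a' = 1) ∧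
    (∀ E ∈ (shear a φ' (c (k + 2)).F).support, E.degree = 8 → E a = 2 → E a' = 2) := by
  haveI : Fact (Nat.Prime 5) := ⟨by norm_num⟩
  set P := (Finset.univ.erase a).erase a' with hP
  obtain ⟨o, ho, hosum, hpair, hrshape, hrk, h5o⟩ := chain_basics hc hr0 hfloor hshade haa hpass hk
  set α := (c k).r a with hα
  set β := (c k).r a' with hβdef
  set t := b k a' with htdef
  have hbk : b k = (Pi.single a' t : Fin 4 → K) + φ + t • ψ := by
    funext i
    by_cases hia' : i = a'
    · rw [hia', Pi.add_apply, Pi.add_apply, Pi.smul_apply, Pi.single_eq_same, hφa', hψa', smul_zero, add_zero, add_zero]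
    · by_cases hia : i = a
      · rw [hia, Pi.add_apply, Pi.add_apply, Pi.smul_apply, Pi.single_eq_of_ne haa, hφa, hψa, smul_zero, add_zero,
          add_zero, ← hjk]
        exact (hw k).2.1
      · rw [Pi.add_apply, Pi.add_apply, Pi.smul_apply, Pi.single_eq_of_ne hia', zero_add, smul_eq_mul]
        exact translation_forced 5 hc hw hr0 hfloor hshade he haa hletters hk hjk hφa hφa' hψa hψa' hφV hψV hia hia'
  have hta : ((Pi.single a' t : Fin 4 → K) + φ + t • ψ) a = 0 := by
    rw [Pi.add_apply, Pi.add_apply, Pi.smul_apply, Pi.single_eq_of_ne haa, hφa, hψa, smul_zero, add_zero, add_zero]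
  have hstep1 : c (k + 1) = CentreBlowup.step 5 Finset.univ a ((Pi.single a' t : Fin 4 → K) + φ + t • ψ) (c k) := by
    rw [(hw k).2.2.2.2, hjk, hbk]
  -- time `k + 1`: the child is `2e_a`
  have hr1 : (c (k + 1)).r = Finsupp.single a (o - 5) := by
    rw [hstep1, step_r_univ 5 a hta (c k) ho hrk]
    ext i
    rw [Finsupp.coe_update, Finsupp.single_apply]
    by_cases hia : i = a
    · rw [hia, Function.update_self, if_pos rfl]
    · rw [Function.update_of_ne hia, Finsupp.filter_apply, if_neg (Ne.symm hia)]
      by_cases hia' : i = a'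
      · rw [hia', Pi.add_apply, Pi.add_apply, Pi.smul_apply, Pi.single_eq_same, hφa', hψa', smul_zero, add_zero,
          add_zero, if_neg ht]
      · rw [hpass k hk i hia hia']; split_ifs <;> rfl
  obtain ⟨o₁, ho₁, ho₁sum, -, -, hrk₁, h5o₁⟩ := chain_basics hc hr0 hfloor hshade haa hpass (k := k + 1) (by omega)
  have hr1a : (c (k + 1)).r a = o - 5 := by rw [hr1, Finsupp.single_eq_same]
  have hr1a' : (c (k + 1)).r a' = 0 := by rw [hr1, Finsupp.single_eq_of_ne haa.symm]
  obtain ⟨ho7, hαβ, ho₁6⟩ : o = 7 ∧ α + β = 3 ∧ o₁ = 6 := ⟨by omega, by omega, by omega⟩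
  -- time `k + 2`: the re-entry step is forced
  obtain ⟨o₂, ho₂, ho₂sum, -, -, hrk₂, h5o₂⟩ := chain_basics hc hr0 hfloor hshade haa hpass (k := k + 2) (by omega)
  have hr2law := step_r_univ 5 (j (k + 1)) (hw (k + 1)).2.1 (c (k + 1)) ho₁ hrk₁
  rw [← (hw (k + 1)).2.2.2.2] at hr2law
  have hj1 : j (k + 1) = a' := by
    rcases hletters (k + 1) (by omega) with hja | hja'
    · exfalso
      have h2a : (c (k + 2)).r a = o₁ - 5 := by rw [hr2law, hja, Finsupp.coe_update, Function.update_self]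
      have h2a' : (c (k + 2)).r a' = 0 := by
        rw [hr2law, hja, Finsupp.coe_update, Function.update_of_ne haa.symm, Finsupp.filter_apply, hr1a']
        split_ifs <;> rfl
      omega
    · exact hja'
  have hb1a : b (k + 1) a = 0 := by
    by_contra hba
    have h2a' : (c (k + 2)).r a' = o₁ - 5 := by rw [hr2law, hj1, Finsupp.coe_update, Function.update_self]
    have h2a : (c (k + 2)).r a = 0 := by
      rw [hr2law, hj1, Finsupp.coe_update, Function.update_of_ne haa, Finsupp.filter_apply, if_neg hba]
    omega
  have hb1 : b (k + 1) = ψ := by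
    funext i
    by_cases hia' : i = a'
    · rw [hia', hψa', ← hj1]; exact (hw (k + 1)).2.1
    · by_cases hia : i = a
      · rw [hia, hψa]; exact hb1a
      · exact reentry_translation_eq 5 hc hw hr0 hfloor hshade he haa hletters hk (Nat.le_succ k)
          (fun t hkt htk => by rw [show t = k by omega]; exact hjk) hj1 hb1a hψa hψa' hψV hia hia'
  -- the child's new `a`-tilt `φ′`, persisting to the grandchild
  obtain ⟨ψ₁, φ', -, -, hφ'a', hφ'a, -, hφ'V⟩ := exists_tilted_frame_at 5 hc hw hr0 hfloor hshade he haa.symm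
    (fun k hk => (hletters k hk).symm) (k := k + 1) (by omega) hj1
  have hφ'V2 : (Pi.single a 1 : Fin 4 → K) + φ' ∈ resVertex (c (k + 2)) :=
    tilt_persists 5 hc hw hr0 hfloor hshade he (k := k + 1) (by omega) hφ'V
      (by rw [hj1, Pi.add_apply, Pi.single_eq_of_ne haa.symm, hφ'a', zero_add])
  have hb1' : b (k + 1) = (Pi.single a (0 : K) : Fin 4 → K) + ψ + (0 : K) • φ' := by
    rw [hb1, Pi.single_zero, zero_add, zero_smul, add_zero]
  have hstep2 : c (k + 2) = CentreBlowup.step 5 Finset.univ a' ((Pi.single a (0 : K) : Fin 4 → K) + ψ + (0 : K) • φ')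
      (c (k + 1)) := by
    rw [(hw (k + 1)).2.2.2.2, hj1, hb1']
  have hr2 : (c (k + 2)).r = Finsupp.single a 2 + Finsupp.single a' 1 := by
    ext i
    rw [hr2law, hj1, Finsupp.coe_update, two_apply haa]
    by_cases hia' : i = a'
    · rw [hia', Function.update_self, if_neg haa.symm, if_pos rfl]; omega
    · rw [Function.update_of_ne hia', Finsupp.filter_apply, hr1, Finsupp.single_apply]
      by_cases hia : i = a
      · rw [if_pos hia.symm, if_pos hia, hia, if_pos hb1a]; omega
      · rw [if_neg (Ne.symm hia), if_neg hia, if_neg hia']; split_ifs <;> rfl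
  have hr2a : (c (k + 2)).r a = 2 := by rw [hr2, two_apply haa, if_pos rfl]
  have hr2a' : (c (k + 2)).r a' = 1 := by rw [hr2, two_apply haa, if_neg haa.symm, if_pos rfl]
  have ho₂7 : o₂ = 7 := by omega
  -- the three polynomials in MOVING FRAMES
  set Θ : Fin 4 → MvPolynomial (Fin 4) K := fun i => (X i : MvPolynomial (Fin 4) K) + C (φ i) * X a + C (ψ i) * X a' +
    C (φ' i) * X a ^ 2 with hΘ
  set F : MvPolynomial (Fin 4) K := aeval Θ (c k).F with hFdef
  set F₁ : MvPolynomial (Fin 4) K := shear a φ' (shear a' ψ (c (k + 1)).F) with hF₁def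
  set F₂ : MvPolynomial (Fin 4) K := shear a φ' (c (k + 2)).F with hF₂def
  have hrs : ∀ i, i ≠ a → i ≠ a' → (c k).r i = 0 := hpass k hk
  have hFsupp := inert_of_straighten_jet 5 ho (by rw [ordZero_sub_degree_eq_of_shade ho (hshade k hk)]; norm_num) hrk haa hrs
    hφa hφa' hψa hψa' hφ'a hφ'a' hφV hψV
  have hrk' : ∀ m ∈ F.support, Finsupp.single a α + Finsupp.single a' β ≤ m := fun m hm => by
    rw [hα, hβdef, ← hrshape]; exact (hFsupp m hm).1
  have hF : ∀ m ∈ F.support, Finsupp.single a α + Finsupp.single a' β ≤ m ∧ 7 ≤ m.degree ∧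
      (m.degree = 7 → degIn P m = 4) := fun m hm => by
    obtain ⟨h1, h2, h3⟩ := hFsupp m hm
    refine ⟨by rw [hα, hβdef, ← hrshape]; exact h1, ho7 ▸ h2, fun h => ?_⟩
    have := h3 (h.trans ho7.symm)
    rw [← hP] at this
    have hrdeg : (c k).r.degree = 3 := by rw [degree_eq_apply_add_apply_add_degIn haa, ← hP,
      show degIn P (c k).r = 0 from degIn_eq_zero_iff.mpr fun i hi =>
        hrs i (Finset.ne_of_mem_erase (Finset.mem_of_mem_erase hi)) (Finset.ne_of_mem_erase hi)]; omega
    omega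
  have hS1 : ∀ e : Fin 4 →₀ ℕ, 5 ≤ e.degree → ¬ IsPthPowerExponent 5 (chartExponent 5 Finset.univ a e) →
      coeff (chartExponent 5 Finset.univ a e) F₁ = coeff e (shear a (Pi.single a' t) F) := by
    intro e h5 hnp
    rw [hF₁def, hstep1, hFdef, hΘ]
    exact coeff_step_frame haa t φ ψ φ' hφa hφa' hψa hψa' hφ'a hφ'a' (c k) (hw k).1 h5 hnp
  have hS1' : ∀ e' ∈ F₁.support, ¬ IsPthPowerExponent 5 e' →
      ∃ e ∈ (shear a (Pi.single a' t) F).support, chartExponent 5 Finset.univ a e = e' := by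
    intro e' he' hnp
    rw [hF₁def, hstep1] at he'
    rw [hFdef, hΘ]
    exact exists_of_mem_support_step_frame haa t φ ψ φ' hφa hφa' hψa hψa' hφ'a hφ'a' (c k) (hw k).1 he' hnp
  -- hF₁: order `6`, the layer `x_a²`, isolation window (isolation is invariant under the straightening)
  have hsh : ∀ (l : Fin 4) (τ : Fin 4 → K) (Q : MvPolynomial (Fin 4) K), ordZero Q ≤ ordZero (shear l τ Q) :=
    fun l τ Q => le_ordZero_aeval _ (fun i => by by_cases h : i = l <;> simp [h]) _
  have hF₁ : ∀ e' ∈ F₁.support, 6 ≤ e'.degree ∧ 2 ≤ e' a := by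
    intro e' he'
    refine ⟨?_, le_apply_of_mem_support_shear_shear haa φ' ψ hψa (fun e he => by
      have := Finsupp.le_def.mp (hrk₁ e he) a; rw [hr1a] at this; omega) he'⟩
    have h1 := Literature.Barriers.ResolutionOfSingularities.ordZero_le_of_coeff_ne_zero _ _
      (MvPolynomial.mem_support_iff.mp he')
    have h2 : ((6 : ℕ) : ℕ∞) ≤ ordZero F₁ := by
      rw [hF₁def, ← ho₁6, ← ho₁]; exact (hsh a' ψ _).trans (hsh a φ' _)
    exact_mod_cast h2.trans h1
  have hF₁' : ∀ e' ∈ F₁.support, 6 ≤ e'.degree := fun e' he' => (hF₁ e' he').1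
  have hwin : ∃ e' ∈ F₁.support, degIn (Finset.univ.erase a') e' < 5 := by
    have hiso : IsIsolated 5 F₁ := by
      rw [hF₁def, isIsolated_shear_iff 5 a hφ'a, isIsolated_shear_iff 5 a' hψa']
      exact (hc (k + 1)).1
    exact exists_mem_support_offAxis_lt 5 hiso a'
  -- the re-entry jet with child parameter `0` IS the child's full linear straightening
  have hfg : (fun i => (X i : MvPolynomial (Fin 4) K) + C (ψ i) * X a' + C (φ' i) * X a + C ((0 : Fin 4 → K) i) * X a' ^ 2) =
      (fun i => aeval (fun l => if l = a then (X a : MvPolynomial (Fin 4) K) else X l + C (φ' l) * X a)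
        (if i = a' then (X a' : MvPolynomial (Fin 4) K) else X i + C (ψ i) * X a')) := by
    funext i
    have haa' : a' ≠ a := fun h => haa h.symm
    by_cases hia' : i = a'
    · rw [hia']
      simp only [hψa', hφ'a', Pi.zero_apply, map_zero, zero_mul, add_zero, if_true, aeval_X, if_neg haa']
    · by_cases hia : i = a
      · rw [hia]
        simp only [hψa, hφ'a, Pi.zero_apply, map_zero, zero_mul, add_zero, if_neg haa, aeval_X, if_pos]
      · simp only [Pi.zero_apply, map_zero, zero_mul, add_zero, if_neg hia', map_add, map_mul, aeval_C, aeval_X,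
          if_neg hia, if_neg haa', algebraMap_eq, hφ'a']
        ring
  have hΘ₁ : aeval (fun i => (X i : MvPolynomial (Fin 4) K) + C (ψ i) * X a' + C (φ' i) * X a +
      C ((0 : Fin 4 → K) i) * X a' ^ 2) (c (k + 1)).F = F₁ := by
    rw [hF₁def, shear_eq_aeval a φ', shear_eq_aeval a' ψ, ← AlgHom.comp_apply, comp_aeval, hfg]
  have hS2 : ∀ e' : Fin 4 →₀ ℕ, 5 ≤ e'.degree → ¬ IsPthPowerExponent 5 (chartExponent 5 Finset.univ a' e') →
      coeff (chartExponent 5 Finset.univ a' e') F₂ = coeff e' F₁ := by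
    intro e' h5 hnp
    have h := coeff_step_frame (c := a') (d := a) haa.symm (0 : K) ψ φ' (0 : Fin 4 → K) hψa' hψa hφ'a' hφ'a rfl rfl
      (c (k + 1)) (hw (k + 1)).1 h5 hnp
    rw [← hstep2, shear_zero, Pi.single_zero, shear_zero] at h
    rw [hF₂def, h, ← hΘ₁]
  have hF₂supp := free_of_straighten_one 5 ho₂
    (by rw [ordZero_sub_degree_eq_of_shade ho₂ (hshade (k + 2) (by omega))]; norm_num) hrk₂ hφ'a
    (fun i hia hφi => hpass (k + 2) (by omega) i hia (by rintro rfl; exact hφi hφ'a')) hφ'V2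
  have hF₂ : ∀ E ∈ F₂.support, 7 ≤ E.degree ∧ (E.degree = 7 → E a = 2) := fun E hE => by
    obtain ⟨-, h7, h7eq⟩ := hF₂supp E hE
    exact ⟨ho₂7 ▸ h7, fun h => by rw [h7eq (h.trans ho₂7.symm), hr2a]⟩
  have hD1 : ∀ {m : Fin 4 →₀ ℕ}, m.degree = 8 → degIn ((Finset.univ.erase a).erase a') m ≤ 1 → coeff m F = 0 :=
    fun hm hκ => coeff_eq_zero_of_degree_eight haa hαβ ht hrk' hS1 hF₁' hS2 hF₂ hm hκ
  have hrow := (rowNine_frobenius haa hαβ ht hrk' hS1 hF₁' hS2 hF₂).1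
  have hseed := seed_dichotomy haa hαβ ht hF hS1 hS1' hF₁ hS2 hF₂ hwin
  -- rows of `x_a`-exponent `2` at the grandchild: `|E| = E a′ + 6` by transport through both steps
  have hchase : ∀ E ∈ F₂.support, E a = 2 → E.degree = E a' + 6 := by
    intro E hE hEa
    have hnpE : ¬ IsPthPowerExponent 5 E := not_isPthPowerExponent_of_not_dvd (i := a) (by rw [hEa]; omega)
    have hE' : E ∈ (shear a' (0 : Fin 4 → K) (shear a φ'
        (CentreBlowup.step 5 Finset.univ a' ((Pi.single a (0 : K) : Fin 4 → K) + ψ + (0 : K) • φ') (c (k + 1))).F)).support := by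
      rw [shear_zero, ← hstep2]; exact hE
    obtain ⟨e', he', hχ⟩ := exists_of_mem_support_step_frame (c := a') (d := a) haa.symm (0 : K) ψ φ' (0 : Fin 4 → K)
      hψa' hψa hφ'a' hφ'a rfl rfl (c (k + 1)) (hw (k + 1)).1 hE' hnpE
    rw [Pi.single_zero, shear_zero] at he'
    have he'F₁ : e' ∈ F₁.support := by rw [← hΘ₁]; exact he'
    have hdegE := degree_chartExponent_univ 5 a' (e := e') (le_trans (by norm_num) (hF₁' e' he'F₁))
    rw [hχ] at hdegE
    have hEa' : E a' = e'.degree - 5 := by rw [← hχ]; exact chartExponent_univ_apply_self 5 a' e'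
    have he'a : e' a = 2 := by rw [← hEa, ← hχ, chartExponent_apply_of_ne 5 Finset.univ haa e']
    -- `e' a = 2` forces `|e'| = 6`: pull back through the shear step
    have hnpe' : ¬ IsPthPowerExponent 5 e' := not_isPthPowerExponent_of_not_dvd (i := a) (by rw [he'a]; omega)
    obtain ⟨ee, hee, hχ'⟩ := hS1' e' he'F₁ hnpe'
    have heea : e' a = ee.degree - 5 := by rw [← hχ']; exact chartExponent_univ_apply_self 5 a ee
    obtain ⟨m, hm, l, hl, heem⟩ := exists_of_mem_support_shear_single haa t F hee
    obtain ⟨hrm, hm7, hm7eq⟩ := hF m hm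
    have heedeg : ee.degree = m.degree := by
      rw [heem, degree_eq_apply_add_apply_add_degIn haa, degree_eq_apply_add_apply_add_degIn haa m,
        shear_target_apply haa, shear_target_apply haa, if_pos rfl, if_neg haa.symm, if_pos rfl]
      have : degIn ((Finset.univ.erase a).erase a') ((m.update a' (m a' - l)).update a (m a + l)) =
          degIn ((Finset.univ.erase a).erase a') m := Finset.sum_congr rfl fun i hi => by
        rw [shear_target_apply haa, if_neg (Finset.ne_of_mem_erase (Finset.mem_of_mem_erase hi)),
          if_neg (Finset.ne_of_mem_erase hi)]
      rw [this]; omega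
    have hm7' : m.degree = 7 := by omega
    have hκ := hm7eq hm7'
    have heea' : ee a' = m a' - l := by rw [heem, shear_target_apply haa, if_neg haa.symm, if_pos rfl]
    have heeaa : ee a = m a + l := by rw [heem, shear_target_apply haa, if_pos rfl]
    have h6 := hF₁' e' he'F₁
    have he'a' : e' a' = ee a' := by rw [← hχ']; exact chartExponent_apply_of_ne 5 Finset.univ haa.symm ee
    have hdege' := degree_chartExponent_univ 5 a (e := ee) (by omega)
    rw [hχ'] at hdege'
    have hsplit := degree_eq_apply_add_apply_add_degIn haa m
    rw [← hP] at hsplit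
    have hma := Finsupp.le_def.mp hrm a
    have hma' := Finsupp.le_def.mp hrm a'
    rw [two_apply haa, if_pos rfl] at hma
    rw [two_apply haa, if_neg haa.symm, if_pos rfl] at hma'
    omega
  have hdeg7 : ∀ E ∈ F₂.support, E.degree = 7 → E a = 2 ∧ E a' = 1 := fun E hE hE7 => by
    have hEa : E a = 2 := (hF₂ E hE).2 hE7
    have := hchase E hE hEa
    exact ⟨hEa, by omega⟩
  have hdeg8 : ∀ E ∈ F₂.support, E.degree = 8 → E a = 2 → E a' = 2 := fun E hE hE8 hEa => by
    have := hchase E hE hEa; omega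
  -- un-shearing: `e_{a′} ∈ Vtx(c (k+2))`
  have hVa' : (Pi.single a' 1 : Fin 4 → K) ∈ resVertex (c (k + 2)) :=
    single_mem_resVertex_of_shear ho₂ hrk₂ (Ne.symm haa) hφ'a
      (fun i hφi => by
        rw [hr2, two_apply haa, if_neg (by rintro rfl; exact hφi hφ'a), if_neg (by rintro rfl; exact hφi hφ'a')])
      (fun E hE hEo => by
        rw [(hdeg7 E hE (hEo.trans ho₂7)).2, hr2, two_apply haa, if_neg (Ne.symm haa), if_pos rfl])
  refine ⟨φ', hφ'a, hφ'a', hφ'V2, hVa', hαβ, hr2, fun m hm hκ => hD1 hm (by rw [← hP]; exact hκ),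
    fun i hi2 hi4 => ?_, hseed, hdeg7, hdeg8⟩
  have h := hrow i (by omega)
  rw [if_neg (by omega), if_neg (by omega), if_neg (by omega), if_neg (by omega)] at h
  rw [hrshape, h]
  ring

end TiltedLoseBoth

end ResCone

end Summit.ResolutionOfSingularities.ResolutionOfSingularities.Theorems.PIDim4

end
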